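import Literature.AnabelianGeometry.EtaleTheta.ThetaCoversProp22iSignToyIndependence

/-!
# [EtTh] Remark 2.1.1 at the typed interface: `inv_ell` is NECESSARY (sign-toy countermodel; toy ≠ print)

Mochizuki, *The Étale Theta Function …* [EtTh], Publ. RIMS 45 (2009), §2, Remark 2.1.1, PRIMS text
p.36 (bib key `MochizukiEtTh2009`): "`C̲^log → C^log` … fails to be Galois in general: no nontrivial
automorphism `∈ Gal(X̲/X)` of odd order descends to an automorphism of `C̲^log` over `C^log`" — typed
as `ThetaCovers.CoverData.Rmk211` (`N_{Π_C}(Π_C̲) ∩ Π_X = Π_X̲`; `ThetaCovers.lean`, seat abc-iut-L2-t2)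
and DISCHARGED over `CoverDataAx` by `CoverDataAx.rmk211_holds` (`ThetaCoversAxioms.lean`), using the
axiom `inv_ell` ("the inversion acts on `Q` by `−1`").

WHAT THIS FILE SHOWS over the sign toys `SignToy.signToy l se sθ hl : CoverData l`
(`ThetaCoversProp22iSignToy.lean`), for odd `l ≥ 3`:
* `SignToy.cb_conj` — the `b`-coordinate of a conjugate `g t g⁻¹` in `(ℤ/l)³ ⋊ ℤˣ`;
* `SignToy.signToy_not_rmk211` — if `¬ se` (the would-be inversions CENTRALISE `Δ̄^ell_X`), then
  `Π_C̲ := {b = 0} ⋊ ℤˣ` (of type `(1, l-tors)±`, part 2) is NORMAL in `Π_C`, so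
  `N_{Π_C}(Π_C̲) ∩ Π_X = Π_X ≠ Π_X̲` and `Rmk211` FAILS; `SignToy.signToy_rmk211` — at the printed sign
  pattern `(se, sθ) = (true, false)` it holds (by `CoverDataAx.rmk211_holds`, BY NAME);
* corollaries `CoverData.not_forall_rmk211_of_odd` — for EVERY odd `l ≥ 3` the universal closure
  `∀ X : CoverData l, X.Rmk211` of the named fact (FACT-LIST F-0599) is REFUTED over the bare interface
  (honest label: schema over `CoverData`, witnessed at `CoverDataAx` instances);
  `CoverData.exists_inv_theta_not_rmk211` — `inv_ell` is NECESSARY for Rmk 2.1.1 at the interface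
  (`pow_mem_barKer`, `inv_theta` holding); `CoverData.exists_rmk211_and_prop22_i` — joint non-vacuity.
STATE OF RECORD (acknowledged, not restated): the `∀ l`-closures of F-0596 / F-0599 were refuted first by
abc-iut-w6-d083's `CoverData.not_forall_prop22_i` / `not_forall_rmk211` (`Discharge/Sec2Prop22iRmk211BareNegative.lean`,
p434578; one abelian toy at `l = 3`, `ι` central); this PROOF-ONLY sequel records the same phenomenon
uniformly in `l` inside the sign-toy family and in the explicit «axiom necessary» form.

HONEST SCOPE. Toy independence at the typed interface only; in print the inversion IS the elliptic `−1`.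
Nothing here takes a side on anything printed. abc-iut cell, seat abc-iut-w6-d081 (W6 row
EtTh:Prop2.2(i); sequel for the sibling row EtTh:Rmk2.1.1). [cite: MochizukiEtTh2009, Rmk 2.1.1 p.36]
-/

namespace Literature.AnabelianGeometry.EtaleTheta

namespace ThetaCovers

namespace SignToy

open Multiplicative

variable {l : ℕ} {se sθ : Bool}

/-- The `b`-coordinate of a conjugate in `(ℤ/l)³ ⋊ ℤˣ`:
`b(g t g⁻¹) = b(g) + sgn_se(g) · b(t) − sgn_se(t) · b(g)`. (toy; no claim about print)
[cite: MochizukiEtTh2009, Rmk 2.1.1 p.36] -/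
theorem cb_conj (g t : G l se sθ) :
    cb (g * t * g⁻¹) = cb g + sgn l se g.right * cb t - sgn l se t.right * cb g := by
  simp only [cb_mul, cb_inv, SemidirectProduct.mul_right, sgn_mul]
  linear_combination (-(sgn l se t.right * cb g)) * sgn_mul_self l se g.right

variable (l se sθ) (hl : Odd l)

/-- If `¬ se`, `Π_C̲ = {b = 0} ⋊ ℤˣ` is normalised by ALL of `Π_C`. (toy; no claim about print)
[cite: MochizukiEtTh2009, Rmk 2.1.1 p.36] -/
theorem mem_normalizer_PiCu (hse : se = false) (g : G l se sθ) :
    g ∈ Subgroup.normalizer (PiCu l se sθ : Set (G l se sθ)) := by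
  subst hse
  rw [Subgroup.mem_set_normalizer_iff]
  intro t
  show cb t = 0 ↔ cb (g * t * g⁻¹) = 0
  rw [cb_conj, sgn_false, sgn_false, one_mul, one_mul, add_sub_cancel_left]

/-- **If `¬ se` (odd `l ≥ 3`), Remark 2.1.1 FAILS in the sign toy**: `N_{Π_C}(Π_C̲) ∩ Π_X = Π_X` contains
`(0, 1, 0) ∉ Π_X̲`. (toy; no claim about print) [cite: MochizukiEtTh2009, Rmk 2.1.1 p.36] -/
theorem signToy_not_rmk211 (hse : se = false) (h1 : 1 < l) : ¬ (signToy l se sθ hl).Rmk211 := by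
  intro h
  haveI : Fact (1 < l) := ⟨h1⟩
  have hN := h (PiCu l se sθ) (isTypeLTorsPm_PiCu l se sθ hl)
  set d : G l se sθ := SemidirectProduct.inl (ofAdd ((0 : ZMod l), (1 : ZMod l), (0 : ZMod l))) with hd
  have hdN : d ∈ Subgroup.normalizer (PiCu l se sθ : Set (G l se sθ)) ⊓ (signToy l se sθ hl).PiX :=
    ⟨mem_normalizer_PiCu l se sθ hse d, rfl⟩
  rw [hN] at hdN
  exact one_ne_zero (hdN.1 : cb d = 0)

/-- At the printed sign pattern `(se, sθ) = (true, false)` Remark 2.1.1 HOLDS in the sign toy (by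
`CoverDataAx.rmk211_holds`, BY NAME). (toy; no claim about print) [cite: MochizukiEtTh2009, Rmk 2.1.1 p.36] -/
theorem signToy_rmk211 : (signToy l true false hl).Rmk211 :=
  (signToyAx l hl).rmk211_holds

end SignToy

namespace CoverData

/-- **For EVERY odd `l ≥ 3`, the universal closure `∀ X : CoverData l, X.Rmk211` is REFUTED** (in the
sign toy with central `ι̲`, `Π_C̲` is normal in `Π_C`); the `∀ l`-closure was refuted first at `l = 3` by
abc-iut-w6-d083's `CoverData.not_forall_rmk211` (same phenomenon). Honest FACT-LIST reading of F-0599: a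
SCHEMA over `CoverData`, witnessed at `CoverDataAx` instances (`CoverDataAx.rmk211_holds`).
(toy independence at the typed interface; no claim about print) [cite: MochizukiEtTh2009, Rmk 2.1.1 p.36] -/
theorem not_forall_rmk211_of_odd {l : ℕ} (hl : Odd l) (h1 : 1 < l) : ¬ ∀ X : CoverData.{0} l, X.Rmk211 :=
  fun h => SignToy.signToy_not_rmk211 l false false hl rfl h1 (h _)

/-- **`inv_ell` is NECESSARY for Remark 2.1.1 at the interface**: a `CoverData l` (odd `l ≥ 3`) in which
`Δ̄_X` has exponent `l` and every element of `Δ_C ∖ Δ_X` acts by `+1` on `Δ̄_Θ` (the axioms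
`pow_mem_barKer`, `inv_theta` of `CoverDataAx`), yet `inv_ell` and Rmk 2.1.1 both fail — the sign toy
`(+, +)`. (toy independence; no claim about print) [cite: MochizukiEtTh2009, Rmk 2.1.1 p.36] -/
theorem exists_inv_theta_not_rmk211 {l : ℕ} (hl : Odd l) (h1 : 1 < l) :
    ∃ X : CoverData.{0} l,
      (∀ d ∈ X.PiX ⊓ X.aug.ker, d ^ l ∈ X.barKer) ∧
      (∀ c ∈ X.aug.ker, c ∉ X.PiX → ∀ t ∈ X.barTheta, c * t * c⁻¹ * t⁻¹ ∈ X.barKer) ∧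
      ¬ (∀ c ∈ X.aug.ker, c ∉ X.PiX → ∀ d ∈ X.PiX ⊓ X.aug.ker, c * d * c⁻¹ * d ∈ X.barTheta) ∧
      ¬ X.Rmk211 :=
  ⟨SignToy.signToy l false false hl, SignToy.signToy_pow_mem l false false hl,
    SignToy.signToy_inv_theta l false false hl rfl, SignToy.signToy_not_inv_ell l false false hl rfl h1,
    SignToy.signToy_not_rmk211 l false false hl rfl h1⟩

/-- Conversely the two refuted closures are jointly WITNESSED at one `CoverData` (the sign toy `(−, +)`,
a `CoverDataAx`): Rmk 2.1.1 and Prop 2.2 (i) hold there together — the schema reading is not vacuous.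
(toy; no claim about print) [cite: MochizukiEtTh2009, Rmk 2.1.1 p.36] -/
theorem exists_rmk211_and_prop22_i {l : ℕ} (hl : Odd l) :
    ∃ X : CoverData.{0} l, X.Rmk211 ∧ X.Prop22_i :=
  ⟨SignToy.signToy l true false hl, SignToy.signToy_rmk211 l hl,
    (SignToy.signToyAx l hl).prop22_i_holds⟩

end CoverData

end ThetaCovers

end Literature.AnabelianGeometry.EtaleTheta
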